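import Mathlib.Data.Finset.Card

/-!
# A verified branch-and-bound checker for "no `k`-subset avoids the listed pairs" certificates

HONEST FRAMING (cell `pub-fluidc`, library seat GADGETS, gen 65; verbatim): *low prior, high
value-of-information experiment on Tao's machine paradigm; NOT a claim that NS blows up.* Generic finite
combinatorics (a certificate checker and its soundness theorem); nothing here is about the Navier–Stokes
equations. Its one client so far is `MidpointFreeBound` (the largest midpoint-free subset of the 44-point
footprint window of the `d₀`-drain coverage argument has 20 points).

THE PROBLEM SHAPE. Positions `0 … n-1`; for each position `i` a list of PAIRS of earlier positions `u, v < i`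
("forbidden with `i`"), each coded as the bitmask `2^u ||| 2^v`; a set of positions is FREE if for none of its
elements `i` it contains both members of a pair listed at `i`. (Client: positions = points in a fixed order,
pairs at `i` = the pairs completing a midpoint triple with `i`; free = midpoint-free.)

THE CERTIFICATE ("Russian doll" search, after Östergård's maximum-clique algorithm [cite: Ostergard2002]):
a table `R : List (ℕ × List ℕ)`, row `i = (c i, masks i)`, where `c i` CLAIMS to bound the size of a free set
of positions `≥ i`. THE CHECKER is plain structural recursion written with `List.rec` (so that the kernel
evaluates it cheaply; measured ≈ 7 000 search nodes / s): `compat` (no listed mask inside the running bitmask),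
`dfs` (include / exclude search over the remaining rows, the running set as a bitmask `chosen` of size `cnt`,
pruned by `cnt + c i < target`; `true` = nothing free of size `target` extends the running set) and
`levelsFrom` (level `i` is accepted iff `c i = c (i+1) + 1` — always sound — or `c i = c (i+1)` AND `dfs`
refutes `c i + 1` free positions `≥ i` including `i`).
SOUNDNESS, proved once for every table (no `decide` here): `dfs_sound` (the search invariant), `levels_sound`
(downward induction on levels) and the packaged `card_le_of_levelsFrom`: if `levelsFrom R 1 = true` then every
free `S ⊆ range R.length` has `#S ≤ c 0`. Completeness is not needed and not claimed. No `Prop` definitions: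
"free" is spelled out as the hypothesis `∀ j ∈ S, ∀ m ∈ masksAt R j, ∃ u, Nat.testBit m u = true ∧ u ∉ S`.
-/

namespace Summit.NavierStokesRegularity.FluidComputer.MidpointFreeSearch

open Finset

/-! ## The checker -/

/-- `true` iff no listed mask is contained in the bitmask `chosen`. [folklore] -/
def compat (chosen : ℕ) (l : List ℕ) : Bool :=
  l.rec (motive := fun _ => Bool) true (fun m _ ih => !(Nat.beq (Nat.land chosen m) m) && ih)

/-- Include / exclude search over the remaining rows (`bit = 2^i` for the head row `i`, `chosen` = the set
built so far as a bitmask, `cnt` = its size): `true` means NO extension avoiding the listed pairs and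
respecting the table bounds reaches `target` elements. [folklore] -/
def dfs (R : List (ℕ × List ℕ)) : ℕ → ℕ → ℕ → ℕ → Bool :=
  R.rec (motive := fun _ => ℕ → ℕ → ℕ → ℕ → Bool)
    (fun _ _ cnt target => Nat.blt cnt target)
    (fun row _ ih => fun bit chosen cnt target =>
      !(Nat.ble target cnt) &&
        (Nat.blt (cnt + row.1) target ||
          ((!(compat chosen row.2) || ih (bit + bit) (Nat.lor chosen bit) (cnt + 1) target)
            && ih (bit + bit) chosen cnt target)))

/-- The bound claimed by the head row (`0` past the end). [folklore] -/
def headC (R : List (ℕ × List ℕ)) : ℕ :=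
  R.rec (motive := fun _ => ℕ) 0 (fun row _ _ => row.1)

/-- The masks of the head row (`[]` past the end). [folklore] -/
def headM (R : List (ℕ × List ℕ)) : List ℕ :=
  R.rec (motive := fun _ => List ℕ) [] (fun row _ _ => row.2)

/-- Level check for every remaining row (`bit = 2^i` for the head row `i`): `c i = c (i+1) + 1`, or
`c i = c (i+1)` and `dfs` refutes `c i + 1` elements with position `i` forced. [folklore] -/
def levelsFrom (R : List (ℕ × List ℕ)) : ℕ → Bool :=
  R.rec (motive := fun _ => ℕ → Bool) (fun _ => true)
    (fun row rest ih => fun bit =>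
      (Nat.beq row.1 (headC rest + 1) || (Nat.beq row.1 (headC rest) && dfs rest (bit + bit) bit 1 (row.1 + 1)))
        && ih (bit + bit))

/-- The bound `c i` of row `i` of a table. [folklore] -/
def cAt (R : List (ℕ × List ℕ)) (i : ℕ) : ℕ := headC (R.drop i)

/-- The masks of row `i` of a table. [folklore] -/
def masksAt (R : List (ℕ × List ℕ)) (i : ℕ) : List ℕ := headM (R.drop i)

/-! ## Soundness (for any table) -/

/-- [folklore] -/
theorem compat_cons (chosen m : ℕ) (l : List ℕ) :
    compat chosen (m :: l) = (!(Nat.beq (Nat.land chosen m) m) && compat chosen l) := rfl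

/-- [folklore] -/
theorem dfs_nil (bit chosen cnt target : ℕ) : dfs [] bit chosen cnt target = Nat.blt cnt target := rfl

/-- [folklore] -/
theorem dfs_cons (row : ℕ × List ℕ) (rest : List (ℕ × List ℕ)) (bit chosen cnt target : ℕ) :
    dfs (row :: rest) bit chosen cnt target =
      (!(Nat.ble target cnt) &&
        (Nat.blt (cnt + row.1) target ||
          ((!(compat chosen row.2) || dfs rest (bit + bit) (Nat.lor chosen bit) (cnt + 1) target)
            && dfs rest (bit + bit) chosen cnt target))) := rfl

/-- [folklore] -/
theorem levelsFrom_cons (row : ℕ × List ℕ) (rest : List (ℕ × List ℕ)) (bit : ℕ) :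
    levelsFrom (row :: rest) bit =
      ((Nat.beq row.1 (headC rest + 1) || (Nat.beq row.1 (headC rest) && dfs rest (bit + bit) bit 1 (row.1 + 1)))
        && levelsFrom rest (bit + bit)) := rfl

/-- A failed compatibility check exhibits a listed mask inside `chosen`. [folklore] -/
theorem exists_of_compat_false (chosen : ℕ) :
    ∀ l : List ℕ, compat chosen l = false → ∃ m ∈ l, Nat.land chosen m = m
  | [], h => by change true = false at h; exact absurd h (by decide)
  | m :: l, h => by
      rw [compat_cons] at h
      cases hb : Nat.beq (Nat.land chosen m) m with
      | true => exact ⟨m, by simp, Nat.eq_of_beq_eq_true hb⟩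
      | false =>
          rw [hb] at h
          simp only [Bool.not_false, Bool.true_and] at h
          obtain ⟨m', hm', h'⟩ := exists_of_compat_false chosen l h
          exact ⟨m', List.mem_cons_of_mem _ hm', h'⟩

/-- Bits of a mask contained in `chosen` are bits of `chosen`. [folklore] -/
theorem testBit_of_land_eq {chosen m : ℕ} (h : Nat.land chosen m = m) (u : ℕ)
    (hu : Nat.testBit m u = true) : Nat.testBit chosen u = true := by
  have h' : (chosen &&& m).testBit u = m.testBit u := by rw [show chosen &&& m = m from h]
  rw [Nat.testBit_and, hu] at h'
  simpa using h'

/-- [folklore] -/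
theorem two_pow_add_self (i : ℕ) : 2 ^ i + 2 ^ i = 2 ^ (i + 1) := by
  rw [Nat.pow_succ, Nat.mul_two]

/-- [folklore] -/
theorem drop_succ_of_drop_cons {R rest : List (ℕ × List ℕ)} {row : ℕ × List ℕ} {i : ℕ}
    (h : row :: rest = R.drop i) : rest = R.drop (i + 1) := by
  rw [← List.tail_drop, ← h]; rfl

/-- SOUNDNESS OF `dfs`. If `dfs` accepts from frontier `i` with `chosen` representing `S ∩ [0, i)` (of size
`cnt`), and `S` (inside the table's index range) avoids every listed pair below each of its elements and obeys
the table bounds on all its tails from `i` on, then `#S < target`. [folklore] -/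
theorem dfs_sound (R : List (ℕ × List ℕ)) :
    ∀ (rest : List (ℕ × List ℕ)) (i chosen cnt target : ℕ) (S : Finset ℕ),
      rest = R.drop i →
      (∀ u, Nat.testBit chosen u = true ↔ u ∈ S ∧ u < i) →
      #(S.filter (· < i)) = cnt →
      S ⊆ range R.length →
      (∀ j ∈ S, ∀ m ∈ masksAt R j, ∃ u, Nat.testBit m u = true ∧ u ∉ S) →
      (∀ j, i ≤ j → #(S.filter (j ≤ ·)) ≤ cAt R j) →
      dfs rest (2 ^ i) chosen cnt target = true →
      #S < target := by
  intro rest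
  induction rest with
  | nil =>
    intro i chosen cnt target S hdrop _ hcnt hsub _ _ hdfs
    rw [dfs_nil] at hdfs
    have hlen : R.length ≤ i := List.drop_eq_nil_iff.1 hdrop.symm
    have hS : S.filter (· < i) = S :=
      filter_true_of_mem (fun u hu => lt_of_lt_of_le (mem_range.1 (hsub hu)) hlen)
    rw [hS] at hcnt
    rw [hcnt]
    simpa using hdfs
  | cons row rest' ih =>
    intro i chosen cnt target S hdrop hrep hcnt hsub hfree hbd hdfs
    rw [dfs_cons, two_pow_add_self] at hdfs
    have hdrop' : rest' = R.drop (i + 1) := drop_succ_of_drop_cons hdrop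
    have hcAt : cAt R i = row.1 := by unfold cAt; rw [← hdrop]; rfl
    have hmasks : masksAt R i = row.2 := by unfold masksAt; rw [← hdrop]; rfl
    have hsplit : #(S.filter (· < i)) + #(S.filter (i ≤ ·)) = #S := by
      have h := card_filter_add_card_filter_not (s := S) (fun u => u < i)
      simpa [not_lt] using h
    simp only [Bool.and_eq_true, Bool.or_eq_true, Bool.not_eq_true'] at hdfs
    obtain ⟨-, hdfs⟩ := hdfs
    rcases hdfs with hprune | ⟨hinc, hexc⟩
    · have h1 : cnt + row.1 < target := by simpa using hprune
      have h2 := hbd i le_rfl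
      rw [hcAt] at h2
      omega
    · by_cases hi : i ∈ S
      · have hcomp : compat chosen row.2 = true := by
          by_contra hc
          rw [Bool.not_eq_true] at hc
          obtain ⟨m, hm, hmeq⟩ := exists_of_compat_false chosen row.2 hc
          rw [← hmasks] at hm
          obtain ⟨u, hu, huS⟩ := hfree i hi m hm
          exact huS ((hrep u).1 (testBit_of_land_eq hmeq u hu)).1
        rcases hinc with hinc | hinc
        · rw [hcomp] at hinc; exact absurd hinc (by decide)
        · refine ih (i + 1) (Nat.lor chosen (2 ^ i)) (cnt + 1) target S hdrop' ?_ ?_ hsub hfree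
            (fun j hj => hbd j (by omega)) hinc
          · intro u
            show (chosen ||| 2 ^ i).testBit u = true ↔ _
            rw [Nat.testBit_or, Bool.or_eq_true, hrep u, Nat.testBit_two_pow, decide_eq_true_eq]
            constructor
            · rintro (⟨h1, h2⟩ | h)
              · exact ⟨h1, by omega⟩
              · subst h; exact ⟨hi, by omega⟩
            · rintro ⟨h1, h2⟩
              rcases Nat.lt_succ_iff_lt_or_eq.1 h2 with h | h
              · exact Or.inl ⟨h1, h⟩
              · exact Or.inr h.symm
          · have hS : S.filter (· < i + 1) = insert i (S.filter (· < i)) := by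
              ext u
              simp only [mem_filter, mem_insert]
              constructor
              · rintro ⟨h1, h2⟩
                rcases Nat.lt_succ_iff_lt_or_eq.1 h2 with h | h
                · exact Or.inr ⟨h1, h⟩
                · exact Or.inl h
              · rintro (h | ⟨h1, h2⟩)
                · subst h; exact ⟨hi, by omega⟩
                · exact ⟨h1, by omega⟩
            rw [hS, card_insert_of_notMem (by simp), hcnt]
      · refine ih (i + 1) chosen cnt target S hdrop' ?_ ?_ hsub hfree (fun j hj => hbd j (by omega)) hexc
        · intro u
          rw [hrep u]
          constructor
          · rintro ⟨h1, h2⟩; exact ⟨h1, by omega⟩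
          · rintro ⟨h1, h2⟩
            refine ⟨h1, ?_⟩
            rcases Nat.lt_succ_iff_lt_or_eq.1 h2 with h | h
            · exact h
            · exact absurd (h ▸ h1) hi
        · have hS : S.filter (· < i + 1) = S.filter (· < i) := by
            ext u
            simp only [mem_filter]
            constructor
            · rintro ⟨h1, h2⟩
              refine ⟨h1, ?_⟩
              rcases Nat.lt_succ_iff_lt_or_eq.1 h2 with h | h
              · exact h
              · exact absurd (h ▸ h1) hi
            · rintro ⟨h1, h2⟩; exact ⟨h1, by omega⟩
          rw [hS, hcnt]

/-- SOUNDNESS OF `levelsFrom`: if the level check accepts from row `i` on, every set of positions (in range)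
avoiding the listed pairs below each of its elements has at most `c j` elements `≥ j`, for every `j ≥ i`. [folklore] -/
theorem levels_sound (R : List (ℕ × List ℕ)) :
    ∀ (rest : List (ℕ × List ℕ)) (i : ℕ), rest = R.drop i → levelsFrom rest (2 ^ i) = true →
      ∀ S : Finset ℕ, S ⊆ range R.length →
        (∀ j ∈ S, ∀ m ∈ masksAt R j, ∃ u, Nat.testBit m u = true ∧ u ∉ S) →
        ∀ j, i ≤ j → #(S.filter (j ≤ ·)) ≤ cAt R j := by
  intro rest
  induction rest with
  | nil =>
    intro i hdrop _ S hsub _ j hj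
    have hlen : R.length ≤ i := List.drop_eq_nil_iff.1 hdrop.symm
    have hS : S.filter (j ≤ ·) = ∅ := by
      ext u
      simp only [mem_filter, notMem_empty, iff_false, not_and]
      intro hu
      have := mem_range.1 (hsub hu)
      omega
    rw [hS]
    simp
  | cons row rest' ih =>
    intro i hdrop hlev S hsub hfree j hj
    rw [levelsFrom_cons, two_pow_add_self] at hlev
    have hdrop' : rest' = R.drop (i + 1) := drop_succ_of_drop_cons hdrop
    have hcAt : cAt R i = row.1 := by unfold cAt; rw [← hdrop]; rfl
    have hcAt1 : cAt R (i + 1) = headC rest' := by unfold cAt; rw [← hdrop']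
    simp only [Bool.and_eq_true, Bool.or_eq_true] at hlev
    obtain ⟨hhead, htail⟩ := hlev
    have IH := ih (i + 1) hdrop' htail S hsub hfree
    rcases Nat.eq_or_lt_of_le hj with rfl | hlt
    · have hnext := IH (i + 1) le_rfl
      rw [hcAt1] at hnext
      rw [hcAt]
      have hge : headC rest' ≤ row.1 := by
        rcases hhead with h | ⟨h, _⟩
        · have := Nat.eq_of_beq_eq_true h; omega
        · have := Nat.eq_of_beq_eq_true h; omega
      by_cases hi : i ∈ S
      · have hS : S.filter (i ≤ ·) = insert i (S.filter (i + 1 ≤ ·)) := by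
          ext u
          simp only [mem_filter, mem_insert]
          constructor
          · rintro ⟨h1, h2⟩
            rcases Nat.eq_or_lt_of_le h2 with h | h
            · exact Or.inl h.symm
            · exact Or.inr ⟨h1, by omega⟩
          · rintro (h | ⟨h1, h2⟩)
            · subst h; exact ⟨hi, le_rfl⟩
            · exact ⟨h1, by omega⟩
        rcases hhead with h | ⟨h, hd⟩
        · have hrow := Nat.eq_of_beq_eq_true h
          rw [hS, card_insert_of_notMem (by simp), hrow]
          omega
        · have hrow := Nat.eq_of_beq_eq_true h
          -- run `dfs_sound` on the tail `S' = S ∩ [i, ∞)` with position `i` forced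
          have hlt := dfs_sound R rest' (i + 1) (2 ^ i) 1 (row.1 + 1) (S.filter (i ≤ ·)) hdrop' ?_ ?_
            ((filter_subset _ S).trans hsub) ?_ ?_ hd
          · omega
          · intro u
            rw [Nat.testBit_two_pow, decide_eq_true_eq, mem_filter]
            constructor
            · rintro rfl; exact ⟨⟨hi, le_rfl⟩, by omega⟩
            · rintro ⟨⟨_, h2⟩, h3⟩; omega
          · rw [card_eq_one]
            refine ⟨i, ?_⟩
            ext u
            simp only [mem_filter, mem_singleton]
            constructor
            · rintro ⟨⟨_, h2⟩, h3⟩; omega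
            · rintro rfl; exact ⟨⟨hi, le_rfl⟩, by omega⟩
          · intro j' hj' m hm
            obtain ⟨u, hu, huS⟩ := hfree j' (mem_filter.1 hj').1 m hm
            exact ⟨u, hu, fun h => huS (mem_filter.1 h).1⟩
          · intro j' hj'
            have hS' : (S.filter (i ≤ ·)).filter (j' ≤ ·) = S.filter (j' ≤ ·) := by
              ext u
              simp only [mem_filter]
              constructor
              · rintro ⟨⟨h1, _⟩, h3⟩; exact ⟨h1, h3⟩
              · rintro ⟨h1, h3⟩; exact ⟨⟨h1, by omega⟩, h3⟩
            rw [hS']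
            exact IH j' hj'
      · have hS : S.filter (i ≤ ·) = S.filter (i + 1 ≤ ·) := by
          ext u
          simp only [mem_filter]
          constructor
          · rintro ⟨h1, h2⟩
            refine ⟨h1, ?_⟩
            rcases Nat.eq_or_lt_of_le h2 with h | h
            · exact absurd (h ▸ h1) hi
            · omega
          · rintro ⟨h1, h2⟩; exact ⟨h1, by omega⟩
        rw [hS]
        exact hnext.trans hge
    · exact IH j hlt

/-- THE PACKAGED SOUNDNESS THEOREM: if the level check accepts the whole table (`bit = 2^0`), every free set of
positions in range has at most `c 0` elements. [folklore] -/
theorem card_le_of_levelsFrom (R : List (ℕ × List ℕ)) (h : levelsFrom R 1 = true) (S : Finset ℕ)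
    (hsub : S ⊆ range R.length)
    (hfree : ∀ j ∈ S, ∀ m ∈ masksAt R j, ∃ u, Nat.testBit m u = true ∧ u ∉ S) : #S ≤ cAt R 0 := by
  have h' := levels_sound R R 0 rfl (by simpa using h) S hsub hfree 0 le_rfl
  have hS : S.filter (0 ≤ ·) = S := filter_true_of_mem (fun _ _ => Nat.zero_le _)
  rw [hS] at h'
  exact h'

end Summit.NavierStokesRegularity.FluidComputer.MidpointFreeSearch
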